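import Literature.RingTheory.FittingIdeal.Basic
import Mathlib.LinearAlgebra.Matrix.Determinant.Basic
import Mathlib.LinearAlgebra.Finsupp.LinearCombination
import Mathlib.LinearAlgebra.Multilinear.Basic
import Mathlib.Data.Fin.Tuple.Basic
import HarnessLib

/-!
# Fitting's lemma: the Fitting ideals are computed by any presentation (Stacks 07Z8; Eisenbud 20.4)

Topic: `Literature/RingTheory/FittingIdeal`. Companion to `Basic.lean`, which defines the `k`-th
Fitting ideal `Module.fittingIdeal R M k` of a module INTRINSICALLY — generated by the `j × j`
minors of relation matrices among ALL generating families of size `j + k` — and proves three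
small facts. To compute with it one needs **Fitting's lemma** (H. Fitting 1936; The Stacks
Project, Tag 07Z8: "Let `R` be a ring. Let `M` be a finite `R`-module. Let `0 → K → R^{⊕n} → M → 0`
and `0 → K' → R^{⊕n'} → M → 0` be two presentations … the ideal generated by the
`(n - k) × (n - k)` minors of the matrix of `K → R^{⊕n}` equals the ideal generated by the
`(n' - k) × (n' - k)` minors of `K' → R^{⊕n'}`"; Eisenbud, *Commutative Algebra*, Cor.-Def. 20.4:
"`Fitt_j(M)` depends only on `M`"), whose proof is: "(1) adding a generator `x_{n+1} = ∑ aᵢ xᵢ`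
does not change the ideal of minors — the new relation matrix is `[[A, 0], [-a, 1]]` up to row
operations — and (2) two generating families are compared through their union." This file
PROVES it for the definition of `Basic.lean`, together with the working corollaries:

* `Module.relMinorIdeal R x j` — the ideal generated by the `j × j` minors `det (ρᵢ(σ i'))` of
  relation matrices (`∑ₗ ρᵢₗ • xₗ = 0`) among ONE family `x : Fin n → M` (columns `σ` any map
  `Fin j → Fin n`; repeated columns contribute `0`);
* `Module.relMinorIdeal_succ_le` — Laplace: `(j+1)`-minors lie in the ideal of `j`-minors;
  `Module.relMinorIdeal_comp_equiv` — invariance under reindexing the family;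
* `Module.relMinorIdeal_cons` / `Module.relMinorIdeal_snoc` — **step (1)**: for `m ∈ span(x)`, the
  `(j+1)`-minors of `(m, x)` generate the same ideal as the `j`-minors of `x` (column operations,
  the bordered determinant `det [[1, a], [b, K]] = det (K - b aᵀ)`, and Laplace expansions);
* `Module.relMinorIdeal_append` and `Module.relMinorIdeal_eq_of_span_eq_top` — **step (2)**: for
  generating families `x` (size `n`) and `y` (size `n'`) and `k ≤ n, n'`, the `(n - k)`-minors of
  `x` and the `(n' - k)`-minors of `y` generate the same ideal;
* `Module.fittingIdeal_eq_relMinorIdeal` — **FITTING'S LEMMA for `Module.fittingIdeal`**: for any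
  generating family `x : Fin n → M`, `Fitt_k(M)` is the ideal of `(n - k)`-minors of the relation
  matrices of `x` (`= R` if `k ≥ n`);
* `Module.fittingIdeal_eq_span_det_submatrix` — **Stacks 07Z6 as printed**: if the rows of a
  matrix `A : Matrix (Fin m) (Fin n) R` generate the relation module of the generating family `x`
  (a presentation `R^m → R^n → M → 0`), then `Fitt_k(M)` is generated by the `(n - k) × (n - k)`
  minors `det (A.submatrix τ σ)` of `A` (multilinearity of the determinant in the rows);
* `Module.fittingIdeal_eq_span_range_of_single_relation` — the case of ONE relation: if the
  relation module of `x : Fin (k + 1) → M` is generated by a single vector `v`, then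
  `Fitt_k(M) = (v₀, …, v_k)` (e.g. `Fitt₁` of `Ω_{B/A}`, `B = A[u, v]/(F)`, is `(∂F/∂u, ∂F/∂v)`,
  the case of de Jong 1996, 2.21–2.23).

## Sources

* The Stacks Project, Tag 07Z6 (Fitting ideals: definition via a presentation), Tag 07Z8
  (Fitting's lemma), Tag 07ZA (basic properties).
* D. Eisenbud, *Commutative Algebra with a View Toward Algebraic Geometry*, GTM 150 (1995),
  §20.2, Cor.-Def. 20.4, Cor. 20.5. [Eisenbud1995]
* H. Fitting, *Die Determinantenideale eines Moduls*, Jahresber. DMV 46 (1936) 195–228.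
-/

namespace Literature.RingTheory.FittingIdeal

universe u v

open Matrix

variable {R : Type u} [CommRing R] {M : Type v} [AddCommGroup M] [Module R M]

/-! ## The ideal of `j`-minors of relation matrices of one family -/

variable (R) in
/-- The ideal generated by the **`j × j` minors of relation matrices** among the family
`x : Fin n → M`: the determinants `det (ρ i (σ i'))_{i,i'}` for `j` relations `ρ₁, …, ρⱼ`
(`∑ₗ ρᵢₗ • xₗ = 0`) and any choice of `j` columns `σ : Fin j → Fin n` (a repeated column gives
`0`). For `x` generating `M` and `j = n - k` this is `Fitt_k(M)` (Fitting's lemma,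
`Module.fittingIdeal_eq_relMinorIdeal`). [cite: Eisenbud1995, §20.2] -/
def Module.relMinorIdeal {n : ℕ} (x : Fin n → M) (j : ℕ) : Ideal R :=
  Ideal.span {d : R | ∃ (ρ : Fin j → Fin n → R) (σ : Fin j → Fin n),
    (∀ i, ∑ l, ρ i l • x l = 0) ∧ d = Matrix.det (Matrix.of fun i i' => ρ i (σ i'))}

/-- The defining generators of `relMinorIdeal`. [folklore] -/
theorem Module.det_mem_relMinorIdeal {n j : ℕ} (x : Fin n → M) (ρ : Fin j → Fin n → R)
    (hρ : ∀ i, ∑ l, ρ i l • x l = 0) (σ : Fin j → Fin n) :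
    Matrix.det (Matrix.of fun i i' => ρ i (σ i')) ∈ Module.relMinorIdeal R x j :=
  Ideal.subset_span ⟨ρ, σ, hρ, rfl⟩

/-- To bound `relMinorIdeal x j` by an ideal it suffices to bound its generating minors.
[folklore] -/
theorem Module.relMinorIdeal_le_iff {n j : ℕ} {x : Fin n → M} {I : Ideal R} :
    Module.relMinorIdeal R x j ≤ I ↔ ∀ (ρ : Fin j → Fin n → R) (σ : Fin j → Fin n),
      (∀ i, ∑ l, ρ i l • x l = 0) → Matrix.det (Matrix.of fun i i' => ρ i (σ i')) ∈ I := by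
  constructor
  · intro h ρ σ hρ
    exact h (Module.det_mem_relMinorIdeal x ρ hρ σ)
  · intro h
    refine Ideal.span_le.2 ?_
    rintro d ⟨ρ, σ, hρ, rfl⟩
    exact h ρ σ hρ

/-- The `0 × 0` minors: `relMinorIdeal x 0 = R` (the empty determinant is `1`). [folklore] -/
theorem Module.relMinorIdeal_zero {n : ℕ} (x : Fin n → M) : Module.relMinorIdeal R x 0 = ⊤ := by
  rw [Ideal.eq_top_iff_one]
  have h := Module.det_mem_relMinorIdeal x (fun i : Fin 0 => (Fin.elim0 i : Fin n → R))
    (fun i => Fin.elim0 i) (fun i => Fin.elim0 i)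
  rwa [Matrix.det_fin_zero] at h

/-- **Laplace**: the `(j+1) × (j+1)` relation minors lie in the ideal of the `j × j` ones
(expand along the first row). [folklore] -/
theorem Module.relMinorIdeal_succ_le {n : ℕ} (x : Fin n → M) (j : ℕ) :
    Module.relMinorIdeal R x (j + 1) ≤ Module.relMinorIdeal R x j := by
  rw [Module.relMinorIdeal_le_iff]
  intro ρ σ hρ
  rw [Matrix.det_succ_row_zero]
  refine Submodule.sum_mem _ (fun c _ => Ideal.mul_mem_left _ _ ?_)
  have h := Module.det_mem_relMinorIdeal x (fun i => ρ i.succ) (fun i => hρ i.succ)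
    (fun i' => σ (c.succAbove i'))
  exact h

/-- A matrix whose first row is arbitrary and whose other rows are (columns of) relations has
determinant in the ideal of `j`-minors (expand along the first row). [folklore] -/
theorem Module.det_cons_mem_relMinorIdeal {n j : ℕ} (x : Fin n → M) (v : Fin (j + 1) → R)
    (ρ : Fin j → Fin n → R) (hρ : ∀ i, ∑ l, ρ i l • x l = 0) (σ : Fin (j + 1) → Fin n) :
    Matrix.det (Matrix.of (Fin.cons v (fun i i' => ρ i (σ i')) :
      Fin (j + 1) → Fin (j + 1) → R)) ∈ Module.relMinorIdeal R x j := by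
  rw [Matrix.det_succ_row_zero]
  refine Submodule.sum_mem _ (fun c _ => Ideal.mul_mem_left _ _ ?_)
  have h := Module.det_mem_relMinorIdeal x ρ hρ (fun i' => σ (c.succAbove i'))
  convert h using 2
  ext i i'
  simp only [Matrix.submatrix_apply, Matrix.of_apply, Fin.cons_succ]

/-- **Reindexing the family does not change the minors ideals.** [folklore] -/
theorem Module.relMinorIdeal_comp_equiv_le {n n' : ℕ} (x : Fin n → M) (e : Fin n' ≃ Fin n)
    (j : ℕ) : Module.relMinorIdeal R (x ∘ e) j ≤ Module.relMinorIdeal R x j := by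
  rw [Module.relMinorIdeal_le_iff]
  intro ρ σ hρ
  have hρ' : ∀ i, ∑ l, (fun i l => ρ i (e.symm l)) i l • x l = 0 := fun i => by
    rw [← hρ i]
    exact (Equiv.sum_comp e.symm (fun l' => ρ i l' • x (e l'))).symm.trans (by simp) |>.symm
  have h := Module.det_mem_relMinorIdeal x (fun i l => ρ i (e.symm l)) hρ' (fun i' => e (σ i'))
  convert h using 2
  ext i i'
  simp only [Matrix.of_apply, Equiv.symm_apply_apply]

/-- Reindexing the family along an equivalence does not change the minors ideals. [folklore] -/
theorem Module.relMinorIdeal_comp_equiv {n n' : ℕ} (x : Fin n → M) (e : Fin n' ≃ Fin n) (j : ℕ) :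
    Module.relMinorIdeal R (x ∘ e) j = Module.relMinorIdeal R x j := by
  refine le_antisymm (Module.relMinorIdeal_comp_equiv_le x e j) ?_
  have h := Module.relMinorIdeal_comp_equiv_le (R := R) (x ∘ e) e.symm j
  rwa [Function.comp_assoc, Equiv.self_comp_symm, Function.comp_id] at h

/-- Reindexing along `Fin.cast`. [folklore] -/
theorem Module.relMinorIdeal_comp_cast {n n' : ℕ} (x : Fin n → M) (h : n' = n) (j : ℕ) :
    Module.relMinorIdeal R (x ∘ Fin.cast h) j = Module.relMinorIdeal R x j :=
  Module.relMinorIdeal_comp_equiv x (finCongr h) j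

/-! ## Relation to `Module.fittingIdeal` -/

/-- The `j`-minors of a generating family of size `j + k` lie in `Fitt_k(M)`. [cite: Eisenbud1995, §20.2] -/
theorem Module.relMinorIdeal_le_fittingIdeal {j k : ℕ} (x : Fin (j + k) → M)
    (hx : Submodule.span R (Set.range x) = ⊤) :
    Module.relMinorIdeal R x j ≤ Module.fittingIdeal R M k := by
  rw [Module.relMinorIdeal_le_iff]
  intro ρ σ hρ
  by_cases hσ : Function.Injective σ
  · exact Module.det_mem_fittingIdeal x hx ρ hρ ⟨σ, hσ⟩
  · -- two equal columns
    obtain ⟨i, i', hii', hne⟩ : ∃ i i', σ i = σ i' ∧ i ≠ i' := by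
      simpa [Function.Injective] using hσ
    rw [Matrix.det_zero_of_column_eq hne (fun k => by simp [hii'])]
    exact Ideal.zero_mem _

/-- `Fitt_k(M)` is contained in any ideal containing the `j`-minors of every generating family of
size `j + k`. [cite: Eisenbud1995, §20.2] -/
theorem Module.fittingIdeal_le_of_forall_relMinorIdeal_le {k : ℕ} {I : Ideal R}
    (h : ∀ (j : ℕ) (x : Fin (j + k) → M), Submodule.span R (Set.range x) = ⊤ →
      Module.relMinorIdeal R x j ≤ I) :
    Module.fittingIdeal R M k ≤ I := by
  refine Ideal.span_le.2 ?_
  rintro d ⟨j, x, ρ, σ, hx, hρ, rfl⟩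
  exact h j x hx (Module.det_mem_relMinorIdeal x ρ hρ σ)

/-! ## Step (1): a redundant generator does not change the ideals of minors -/

section Cons

variable {n : ℕ}

/-- The relations of `x` padded by `0`, and the relation `(1, -a)` expressing `m = ∑ aₗ xₗ`, are
relations of `(m, x)`; bordering a relation minor of `x` by them gives the same determinant. Hence
the `j`-minors of `x` are `(j+1)`-minors of `(m, x)`. [cite: Eisenbud1995, §20.2] -/
theorem Module.relMinorIdeal_le_relMinorIdeal_cons (x : Fin n → M) {m : M} {a : Fin n → R}
    (ha : ∑ l, a l • x l = m) (j : ℕ) :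
    Module.relMinorIdeal R x j ≤ Module.relMinorIdeal R (Fin.cons m x : Fin (n + 1) → M) (j + 1) := by
  rw [Module.relMinorIdeal_le_iff]
  intro ρ σ hρ
  -- the bordered relations and columns
  let ρ' : Fin (j + 1) → Fin (n + 1) → R :=
    Fin.cons (Fin.cons 1 (fun l => -a l) : Fin (n + 1) → R) (fun i => Fin.cons 0 (ρ i))
  let σ' : Fin (j + 1) → Fin (n + 1) := Fin.cons 0 (fun i' => (σ i').succ)
  have hρ' : ∀ i, ∑ l, ρ' i l • (Fin.cons m x : Fin (n + 1) → M) l = 0 := by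
    intro i
    refine Fin.cases ?_ (fun i => ?_) i
    · rw [Fin.sum_univ_succ]
      simp only [ρ', Fin.cons_zero, Fin.cons_succ, one_smul, neg_smul, Finset.sum_neg_distrib, ha,
        add_neg_cancel]
    · rw [Fin.sum_univ_succ]
      simp only [ρ', Fin.cons_succ, Fin.cons_zero, zero_smul, zero_add, hρ i]
  have hmem := Module.det_mem_relMinorIdeal (Fin.cons m x : Fin (n + 1) → M) ρ' hρ' σ'
  -- its determinant is the given minor: expand along the first column `(1, 0, …, 0)`
  have hdet : Matrix.det (Matrix.of fun i i' => ρ' i (σ' i')) =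
      Matrix.det (Matrix.of fun i i' => ρ i (σ i')) := by
    rw [Matrix.det_succ_column_zero, Fin.sum_univ_succ]
    have h0 : ∀ i : Fin j, (Matrix.of fun i i' => ρ' i (σ' i')) i.succ 0 = 0 := fun i => by
      simp [ρ', σ']
    simp only [h0, mul_zero, zero_mul, Finset.sum_const_zero, add_zero, Fin.val_zero, pow_zero,
      one_mul, Matrix.of_apply]
    have h00 : ρ' 0 (σ' 0) = 1 := by simp [ρ', σ']
    rw [h00, one_mul]
    congr 1
  rw [← hdet]
  exact hmem

/-- **Fitting's step (1)**, the substantial inclusion: for `m = ∑ aₗ xₗ`, every `(j+1)`-minor of a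
relation matrix of `(m, x)` lies in the ideal of `j`-minors of relation matrices of `x`. With
`bᵢ` the `m`-coefficients and `kᵢ = cᵢ + bᵢ a` (relations of `x`) the rows: if the `m`-column is
among the chosen columns, column operations turn the other columns into columns of `k`, and one
expands along the `m`-column; if not, the minor is `det (K - b aᵀ) = det [[1, aᵀ], [b, K]]`,
which one expands along the first column and then along the row `aᵀ`. [cite: Eisenbud1995, §20.2] -/
theorem Module.relMinorIdeal_cons_le (x : Fin n → M) {m : M} {a : Fin n → R}
    (ha : ∑ l, a l • x l = m) (j : ℕ) :
    Module.relMinorIdeal R (Fin.cons m x : Fin (n + 1) → M) (j + 1) ≤ Module.relMinorIdeal R x j := by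
  rw [Module.relMinorIdeal_le_iff]
  intro ρ' σ' hρ'
  -- the target is everything when `j = 0`
  rcases Nat.eq_zero_or_pos j with rfl | hj
  · rw [Module.relMinorIdeal_zero]
    trivial
  set A : Matrix (Fin (j + 1)) (Fin (j + 1)) R := Matrix.of fun i i' => ρ' i (σ' i') with hA
  -- `b` = coefficients of `m`, `c` = the rest, `k = c + b a` are relations of `x`
  let b : Fin (j + 1) → R := fun i => ρ' i 0
  let c : Fin (j + 1) → Fin n → R := fun i l => ρ' i l.succ
  let k : Fin (j + 1) → Fin n → R := fun i l => c i l + b i * a l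
  have hk : ∀ i, ∑ l, k i l • x l = 0 := by
    intro i
    have h := hρ' i
    rw [Fin.sum_univ_succ] at h
    simp only [Fin.cons_zero, Fin.cons_succ] at h
    simp only [k, add_smul, Finset.sum_add_distrib, mul_smul, ← Finset.smul_sum, ha]
    rw [add_comm]
    exact h
  by_cases h0 : ∃ p, σ' p = 0
  · -- Case A: the `m`-column is chosen, at position `p`
    obtain ⟨p, hp⟩ := h0
    by_cases h2 : ∃ q, q ≠ p ∧ σ' q = 0
    · -- chosen twice: two equal columns
      obtain ⟨q, hqp, hq⟩ := h2
      have hz : A.det = 0 :=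
        Matrix.det_zero_of_column_eq hqp (fun i => by simp [hA, hp, hq])
      rw [hz]
      exact Ideal.zero_mem _
    push Not at h2
    -- a default element of `Fin n` (from a column other than `p`, which is an `x`-column)
    obtain ⟨j₀, rfl⟩ : ∃ j₀, j = j₀ + 1 := ⟨j - 1, by omega⟩
    have hq₀ : σ' (p.succAbove 0) ≠ 0 := h2 _ (Fin.succAbove_ne p 0)
    let d₀ : Fin n := (σ' (p.succAbove 0)).pred hq₀
    let τ : Fin (j₀ + 1 + 1) → Fin n := fun q => if h : σ' q = 0 then d₀ else (σ' q).pred h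
    have hτ : ∀ q, q ≠ p → σ' q = (τ q).succ := fun q hq => by
      simp only [τ, dif_neg (h2 q hq), Fin.succ_pred]
    -- column operations: add `a (τ q)` times the `m`-column to the column `q ≠ p`
    let B : Matrix (Fin (j₀ + 1 + 1)) (Fin (j₀ + 1 + 1)) R :=
      Matrix.of fun i q => if q = p then b i else k i (τ q)
    have hdet : B.det = A.det := by
      rw [← Matrix.det_transpose B, ← Matrix.det_transpose A]
      refine Matrix.det_eq_of_forall_row_eq_smul_add_const
        (fun q => if q = p then 0 else a (τ q)) p (if_pos rfl) (fun q i => ?_)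
      by_cases hq : q = p
      · subst hq
        simp [B, hA, hp, b]
      · simp only [Matrix.transpose_apply, B, hA, Matrix.of_apply, if_neg hq, hp, k, c, b]
        rw [hτ q hq]
        ring
    rw [← hdet, Matrix.det_succ_column B p]
    refine Submodule.sum_mem _ (fun i _ => Ideal.mul_mem_left _ _ ?_)
    have hmem := Module.det_mem_relMinorIdeal x (fun i₁ => k (i.succAbove i₁)) (fun i₁ => hk _)
      (fun i₁' => τ (p.succAbove i₁'))
    convert hmem using 2
    ext i₁ i₁'
    simp [B, Matrix.submatrix_apply, Fin.succAbove_ne]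
  · -- Case B: only `x`-columns are chosen
    push Not at h0
    let τ : Fin (j + 1) → Fin n := fun q => (σ' q).pred (h0 q)
    have hτ : ∀ q, σ' q = (τ q).succ := fun q => by simp only [τ, Fin.succ_pred]
    have hAk : ∀ i q, A i q = k i (τ q) - b i * a (τ q) := fun i q => by
      simp only [hA, Matrix.of_apply, hτ q, k, c]
      ring
    -- the bordered matrices `C = [[1, aᵀ], [b, K]]` and `C' = [[1, aᵀ], [0, A]]`
    let r₀ : Fin (j + 1 + 1) → R := Fin.cons 1 (fun q => a (τ q))
    let C : Matrix (Fin (j + 1 + 1)) (Fin (j + 1 + 1)) R :=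
      Matrix.of (Fin.cons r₀ (fun i => Fin.cons (b i) (fun q => k i (τ q))) :
        Fin (j + 1 + 1) → Fin (j + 1 + 1) → R)
    let C' : Matrix (Fin (j + 1 + 1)) (Fin (j + 1 + 1)) R :=
      Matrix.of (Fin.cons r₀ (fun i => Fin.cons 0 (fun q => A i q)) :
        Fin (j + 1 + 1) → Fin (j + 1 + 1) → R)
    -- row operations: row `i+1` of `C` is row `i+1` of `C'` plus `bᵢ` times row `0`
    have hCC' : C.det = C'.det := by
      refine Matrix.det_eq_of_forall_row_eq_smul_add_const (Fin.cons 0 b : Fin (j + 1 + 1) → R) 0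
        (by simp) (fun i q' => ?_)
      refine Fin.cases ?_ (fun i => ?_) i
      · simp [C, C']
      · refine Fin.cases ?_ (fun q => ?_) q'
        · simp [C, C', r₀]
        · simp only [C, C', r₀, Matrix.of_apply, Fin.cons_succ, Fin.cons_zero, hAk]
          ring
    -- `det C' = det A`: expand along the first column `(1, 0, …, 0)`
    have hC'A : C'.det = A.det := by
      rw [Matrix.det_succ_column_zero, Fin.sum_univ_succ]
      have h0' : ∀ i : Fin (j + 1), C' i.succ 0 = 0 := fun i => by simp [C']
      simp only [h0', mul_zero, zero_mul, Finset.sum_const_zero, add_zero, Fin.val_zero, pow_zero,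
        one_mul]
      have h00 : C' 0 0 = 1 := by simp [C', r₀]
      rw [h00, one_mul]
      congr 1
    -- `det C` lies in the ideal: expand along the first column
    have hC : C.det ∈ Module.relMinorIdeal R x j := by
      rw [Matrix.det_succ_column_zero, Fin.sum_univ_succ]
      refine Ideal.add_mem _ (Ideal.mul_mem_left _ _ ?_)
        (Submodule.sum_mem _ (fun i₀ _ => Ideal.mul_mem_left _ _ ?_))
      · -- the term of the entry `1`: a `(j+1)`-minor of the relations `k`
        refine Module.relMinorIdeal_succ_le x j ?_
        have hmem := Module.det_mem_relMinorIdeal x k hk τ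
        convert hmem using 2
        ext i q
        simp [C, Matrix.submatrix_apply]
      · -- the term of the entry `bᵢ₀`: first row `aᵀ`, the other rows relations
        have hmem := Module.det_cons_mem_relMinorIdeal x (fun q => a (τ q))
          (fun i₁ => k (i₀.succAbove i₁)) (fun i₁ => hk _) τ
        convert hmem using 2
        ext i₁ q
        refine Fin.cases ?_ (fun i₁ => ?_) i₁
        · have h := Fin.succ_succAbove_zero (n := j + 1) i₀
          simp [C, r₀, Matrix.submatrix_apply, h]
        · simp [C, Matrix.submatrix_apply, Fin.succ_succAbove_succ]
    rw [← hC'A, ← hCC']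
    exact hC

/-- **Fitting's step (1)** (Stacks 07Z8, proof; Eisenbud Cor.-Def. 20.4, proof): adjoining a
redundant generator `m ∈ span(x)` in front, the `(j+1)`-minors of relation matrices of `(m, x)`
generate the same ideal as the `j`-minors of relation matrices of `x`. [cite: Eisenbud1995, Cor. 20.4] -/
theorem Module.relMinorIdeal_cons (x : Fin n → M) {m : M}
    (hm : m ∈ Submodule.span R (Set.range x)) (j : ℕ) :
    Module.relMinorIdeal R (Fin.cons m x : Fin (n + 1) → M) (j + 1) = Module.relMinorIdeal R x j := by
  obtain ⟨a, ha⟩ := (Submodule.mem_span_range_iff_exists_fun R).1 hm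
  exact le_antisymm (Module.relMinorIdeal_cons_le x ha j)
    (Module.relMinorIdeal_le_relMinorIdeal_cons x ha j)

/-- Step (1) at the end of the family: adjoining a redundant generator `m ∈ span(x)` last.
[cite: Eisenbud1995, Cor. 20.4] -/
theorem Module.relMinorIdeal_snoc (x : Fin n → M) {m : M}
    (hm : m ∈ Submodule.span R (Set.range x)) (j : ℕ) :
    Module.relMinorIdeal R (Fin.snoc x m : Fin (n + 1) → M) (j + 1) = Module.relMinorIdeal R x j := by
  have hsnoc : (Fin.snoc x m : Fin (n + 1) → M) =
      (Fin.cons m (x ∘ Fin.rev) : Fin (n + 1) → M) ∘ Fin.revPerm := by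
    funext i
    have h := congrFun (Fin.snoc_comp_rev m x) (Fin.rev i)
    simp only [Function.comp_apply, Fin.rev_rev] at h
    simpa [Fin.revPerm_apply] using h
  have hm' : m ∈ Submodule.span R (Set.range (x ∘ Fin.rev)) := by
    rwa [Set.range_comp, Fin.rev_surjective.range_eq, Set.image_univ]
  rw [hsnoc, Module.relMinorIdeal_comp_equiv _ Fin.revPerm, Module.relMinorIdeal_cons _ hm',
    show (x ∘ Fin.rev : Fin n → M) = x ∘ Fin.revPerm from rfl, Module.relMinorIdeal_comp_equiv]

end Cons

/-! ## Step (2): two generating families, through their union -/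

section Append

variable {n n' : ℕ}

/-- Adjoining at the end a family `y` of `n'` redundant elements raises the minors ideals by
`n'` sizes: `relMinorIdeal (x ++ y) (j + n') = relMinorIdeal x j` (step (1), `n'` times).
[cite: Eisenbud1995, Cor. 20.4] -/
theorem Module.relMinorIdeal_append (x : Fin n → M) (y : Fin n' → M)
    (hy : ∀ i, y i ∈ Submodule.span R (Set.range x)) (j : ℕ) :
    Module.relMinorIdeal R (Fin.append x y) (j + n') = Module.relMinorIdeal R x j := by
  induction n' with
  | zero =>
    rw [Fin.append_right_nil x y rfl]
    exact Module.relMinorIdeal_comp_cast x _ j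
  | succ n' ih =>
    have hy' : y = Fin.snoc (Fin.init y) (y (Fin.last n')) := (Fin.snoc_init_self y).symm
    rw [hy', Fin.append_snoc]
    change Module.relMinorIdeal R
      (Fin.snoc (Fin.append x (Fin.init y)) (y (Fin.last n')) : Fin (n + n' + 1) → M)
      (j + n' + 1) = _
    rw [Module.relMinorIdeal_snoc _ ?_, ih (Fin.init y) (fun i => hy _)]
    refine Submodule.span_mono ?_ (hy (Fin.last n'))
    rintro _ ⟨i, rfl⟩
    exact ⟨Fin.castAdd n' i, Fin.append_left x _ i⟩

/-- Swapping the two blocks of a concatenated family does not change the minors ideals.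
[folklore] -/
theorem Module.relMinorIdeal_append_comm (x : Fin n → M) (y : Fin n' → M) (j : ℕ) :
    Module.relMinorIdeal R (Fin.append x y) j = Module.relMinorIdeal R (Fin.append y x) j := by
  let e : Fin (n' + n) ≃ Fin (n + n') :=
    finSumFinEquiv.symm.trans ((Equiv.sumComm (Fin n') (Fin n)).trans finSumFinEquiv)
  have he : Fin.append y x = Fin.append x y ∘ e := by
    funext t
    obtain ⟨s, rfl⟩ := finSumFinEquiv.surjective t
    rcases s with i | i
    · simp [e]
    · simp [e]
  rw [he, Module.relMinorIdeal_comp_equiv]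

/-- **Fitting's step (2)** (Stacks 07Z8; Eisenbud Cor.-Def. 20.4): for two generating families
`x` (size `n`) and `y` (size `n'`) and `k ≤ n, n'`, the `(n - k)`-minors of relation matrices of
`x` and the `(n' - k)`-minors of relation matrices of `y` generate the same ideal — both equal
the `(n + n' - k)`-minors of `x ++ y`. [cite: Eisenbud1995, Cor. 20.4] -/
theorem Module.relMinorIdeal_eq_of_span_eq_top (x : Fin n → M) (y : Fin n' → M)
    (hx : Submodule.span R (Set.range x) = ⊤) (hy : Submodule.span R (Set.range y) = ⊤)
    {k : ℕ} (hk : k ≤ n) (hk' : k ≤ n') :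
    Module.relMinorIdeal R x (n - k) = Module.relMinorIdeal R y (n' - k) := by
  have h1 := Module.relMinorIdeal_append x y (fun i => by rw [hx]; trivial) (n - k)
  have h2 := Module.relMinorIdeal_append y x (fun i => by rw [hy]; trivial) (n' - k)
  rw [← Module.relMinorIdeal_append_comm x y] at h2
  rw [← h1, ← h2, show n - k + n' = n' - k + n by omega]

end Append

/-! ## Fitting's lemma -/

/-- The range of a family is unchanged by `Fin.cast`. [folklore] -/
theorem Set.range_comp_finCast {α : Type*} {n n' : ℕ} (x : Fin n → α) (h : n' = n) :
    Set.range (x ∘ Fin.cast h) = Set.range x := by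
  rw [Set.range_comp, show Set.range (Fin.cast h) = Set.univ from (finCongr h).surjective.range_eq,
    Set.image_univ]

/-- **FITTING'S LEMMA** (H. Fitting 1936; The Stacks Project, Tag 07Z8; Eisenbud, *Commutative
Algebra*, Cor.-Def. 20.4: "the ideal `Fitt_j(M)` … depends only on `M`") for the intrinsic
`Module.fittingIdeal` of `Basic.lean`: for ANY generating family `x₁, …, xₙ` of `M`, `Fitt_k(M)`
is the ideal generated by the `(n - k) × (n - k)` minors of the matrices of relations among
`x₁, …, xₙ` (and is `R` when `k ≥ n`). [cite: Eisenbud1995, Cor. 20.4] -/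
theorem Module.fittingIdeal_eq_relMinorIdeal {n : ℕ} (x : Fin n → M)
    (hx : Submodule.span R (Set.range x) = ⊤) (k : ℕ) :
    Module.fittingIdeal R M k = Module.relMinorIdeal R x (n - k) := by
  by_cases hk : k ≤ n
  · apply le_antisymm
    · refine Module.fittingIdeal_le_of_forall_relMinorIdeal_le fun j y hy => ?_
      rw [Module.relMinorIdeal_eq_of_span_eq_top x y hx hy hk (Nat.le_add_left k j),
        Nat.add_sub_cancel]
    · have h := Module.relMinorIdeal_le_fittingIdeal (R := R) (M := M) (j := n - k) (k := k)
        (x ∘ Fin.cast (Nat.sub_add_cancel hk)) (by rw [Set.range_comp_finCast, hx])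
      rwa [Module.relMinorIdeal_comp_cast] at h
  · -- `k > n`: both sides are everything (`M` is generated by `n < k` elements)
    push Not at hk
    rw [show n - k = 0 by omega, Module.relMinorIdeal_zero]
    have hkn : k = n + (k - n) := by omega
    refine Module.fittingIdeal_eq_top_of_span_eq_top
      (Fin.append x (0 : Fin (k - n) → M) ∘ Fin.cast hkn) ?_
    apply top_unique
    rw [← hx]
    refine Submodule.span_mono ?_
    rintro _ ⟨i, rfl⟩
    refine ⟨Fin.cast hkn.symm (Fin.castAdd (k - n) i), ?_⟩
    have hc : Fin.cast hkn (Fin.cast hkn.symm (Fin.castAdd (k - n) i)) = Fin.castAdd (k - n) i :=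
      Fin.ext rfl
    simp only [Function.comp_apply, hc, Fin.append_left]

/-- **Stacks 07Z6 as printed — `Fitt_k(M)` from a presentation.** If `x₁, …, xₙ` generate `M`
and the rows of `A : Matrix (Fin m) (Fin n) R` are relations among them generating all
relations (i.e. `R^m —A→ R^n —x→ M → 0` is a presentation), then `Fitt_k(M)` is the ideal
generated by the `(n - k) × (n - k)` minors `det (A.submatrix τ σ)` of `A` ("Let
`0 → K → R^{⊕n} → M → 0` be a presentation of `M`. Let `I ⊂ R` be the ideal generated by the
`(n - k) × (n - k)` minors of the matrix …"; rows or columns may repeat, contributing `0`). By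
Fitting's lemma and multilinearity of the determinant in the rows: a relation matrix is `B · A`
rowwise, and `det` of rows `∑ₜ Bᵢₜ Aₜ` is `∑_r (∏ᵢ B_{i, r i}) det (A_{r i, σ i'})`.
[cite: StacksProject, Tag 07Z6] -/
theorem Module.fittingIdeal_eq_span_det_submatrix {n m : ℕ} (x : Fin n → M)
    (hx : Submodule.span R (Set.range x) = ⊤) (A : Matrix (Fin m) (Fin n) R)
    (hA : ∀ t, ∑ l, A t l • x l = 0)
    (hgen : ∀ ρ : Fin n → R, ∑ l, ρ l • x l = 0 → ρ ∈ Submodule.span R (Set.range A)) (k : ℕ) :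
    Module.fittingIdeal R M k = Ideal.span {d : R | ∃ (τ : Fin (n - k) → Fin m)
      (σ : Fin (n - k) → Fin n), d = Matrix.det (A.submatrix τ σ)} := by
  rw [Module.fittingIdeal_eq_relMinorIdeal x hx k]
  apply le_antisymm
  · rw [Module.relMinorIdeal_le_iff]
    intro ρ σ hρ
    -- each row `ρ i` is a combination `∑ₜ B i t • A t` of rows of `A`
    choose B hB using fun i => (Submodule.mem_span_range_iff_exists_fun R).1 (hgen (ρ i) (hρ i))
    -- multilinear expansion of the determinant in the rows
    have hX : (Matrix.of fun i i' => ρ i (σ i')) =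
        Matrix.of (fun i => ∑ t, B i t • fun i' => A t (σ i')) := by
      ext i i'
      simp only [Matrix.of_apply, Finset.sum_apply, Pi.smul_apply, smul_eq_mul]
      rw [← hB i]
      simp only [Finset.sum_apply, Pi.smul_apply, smul_eq_mul]
    have hsum := MultilinearMap.map_sum
      (Matrix.detRowAlternating : (Fin (n - k) → R) [⋀^Fin (n - k)]→ₗ[R] R).toMultilinearMap
      (fun i t => B i t • fun i' => A t (σ i'))
    simp only [AlternatingMap.coe_multilinearMap, MultilinearMap.map_smul_univ] at hsum
    rw [hX]
    change Matrix.detRowAlternating (fun i => ∑ t, B i t • fun i' => A t (σ i')) ∈ _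
    rw [hsum]
    refine Submodule.sum_mem _ (fun r _ => ?_)
    rw [smul_eq_mul]
    refine Ideal.mul_mem_left _ _ (Ideal.subset_span ⟨r, σ, ?_⟩)
    rfl
  · refine Ideal.span_le.2 ?_
    rintro d ⟨τ, σ, rfl⟩
    exact Module.det_mem_relMinorIdeal x (fun i => A (τ i)) (fun i => hA _) σ

/-- **`Fitt_k` of a module with one relation among `k + 1` generators.** If `x₀, …, x_k`
generate `M` and every relation among them is a multiple of the single relation `v`
(`∑ vₗ xₗ = 0`), then `Fitt_k(M) = (v₀, …, v_k)` — the `1 × 1` minors of the presentation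
`R —v→ R^{k+1} → M → 0` (Stacks 07Z6). This is the shape of `Fitt₁(Ω_{B/A})` for a relative
hypersurface `B = A[u, v]/(F)`: `Ω_{B/A} = (B du ⊕ B dv)/(F_u du + F_v dv)`, so
`Fitt₁ = (F_u, F_v)` (de Jong 1996, 2.21, 2.23: "the trace of `Sing(f)` on the scheme `Spec B`
is given by the ideal `(u, v) ⊂ B`" for `F = uv - h`). [cite: StacksProject, Tag 07Z6] -/
theorem Module.fittingIdeal_eq_span_range_of_single_relation {k : ℕ} (x : Fin (k + 1) → M)
    (hx : Submodule.span R (Set.range x) = ⊤) (v : Fin (k + 1) → R) (hv : ∑ l, v l • x l = 0)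
    (hgen : ∀ ρ : Fin (k + 1) → R, ∑ l, ρ l • x l = 0 → ρ ∈ Submodule.span R {v}) :
    Module.fittingIdeal R M k = Ideal.span (Set.range v) := by
  have h := Module.fittingIdeal_eq_span_det_submatrix x hx (Matrix.of fun _ : Fin 1 => v)
    (fun _ => hv) (fun ρ hρ => by
      have hr : Set.range (Matrix.of fun _ : Fin 1 => v) = {v} := by
        ext w
        simp only [Set.mem_range, Set.mem_singleton_iff]
        exact ⟨fun ⟨_, h⟩ => h.symm, fun h => ⟨0, h.symm⟩⟩
      rw [hr]
      exact hgen ρ hρ) k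
  rw [h, Nat.add_sub_cancel_left]
  congr 1
  ext d
  simp only [Set.mem_setOf_eq, Set.mem_range]
  constructor
  · rintro ⟨τ, σ, rfl⟩
    exact ⟨σ 0, by rw [Matrix.det_unique]; rfl⟩
  · rintro ⟨l, rfl⟩
    exact ⟨fun _ => 0, fun _ => l, by rw [Matrix.det_unique]; rfl⟩

end Literature.RingTheory.FittingIdeal
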